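import Summits.CriticalPhenomena.Ising3DConformalLimit.Theorems.PlantedPinningMoebiusLimitExistsLocalWardTight
import HarnessLib

/-!
# The residual of crux `MoebiusLimitExists` (stmt-CriticalPhenomena-1344) in POINTWISE-LOCAL form
(line `Sketch` v15, lead prover-line-stmt-CriticalPhenomena-1344-c18-0; THEOREM-ONLY, `--supports stmt-CriticalPhenomena-1344`)

Since every normalised non-degenerate Euclidean scale-covariant pointwise scaling limit `S` of the critical `ℤ³` correlators is real-analytic
on all non-coincident configurations (`MoebiusLimitExistsLocalWard.analyticOnNhd_limit`, p157368), its weak special-conformal Ward identities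
can be replaced by the POINTWISE first-order identities `DS_n(x)·K_b(x) = 2Δ (Σᵢ ⟪b, xᵢ⟫) S_n(x)` (`stub_ward_of_pointwise` p157117 /
`stub_pointwise_of_ward` p156884):

* `sctWardPointwise_iff_sctWardWeak_of_limit` — for such limits `SCTWardPointwise S Δ' n ⟺ SCTWardWeak S Δ' n` at every level and weight
  (the `C¹` equivalence announced in `Literature/Probability/LatticeModels/SCTWardIdentity.lean`, discharged for Ising₃ limits);
* `localPointwiseK1_iff_isMoebiusCovariant_of_limit` — Möbius covariance ⟺ at each even level `n ≥ 4` the pointwise `K_{e₀}` identity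
  holds on SOME non-empty open set of configurations;
* **item 1982 ⟺ the bare local POINTWISE `K_{e₀}` upgrade** (`inversionUpgradeNormalised_iff_localPointwiseK1Upgrade`, registered anchor) and
  **crux ⟺ 1981 ∧ 7⁗_loc,pt** (`MoebiusLimitExists_iff_existence_and_localPointwiseK1Strict`): the conformal content of the 3D-Ising scaling limit
  is the first-order linear PDE `Σᵢ K_{e₀}(xᵢ)·∇ᵢ S_n = 2Δ (Σᵢ ⟪e₀, xᵢ⟫) S_n` on an arbitrarily small open set of `n`-point configurations, at the
  even levels `n ≥ 4` — no test functions, no integrals.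

References: Di Francesco–Mathieu–Sénéchal 1997 §4.3.1 (4.51)–(4.54) [FrancescoMathieuSenechal1997]; Glimm–Jaffe 1987 §6.1 [GlimmJaffe1987];
Duminil-Copin, ICM 2022 §8.4 [DuminilCopinICM2022].  No definitions, no `sorry`.
-/

noncomputable section

namespace Summit.CriticalPhenomena.Ising3DConformalLimit.MoebiusLimitExistsLocalWard

open Filter Topology MeasureTheory Set
open scoped RealInnerProductSpace
open Literature.Probability.LatticeModels Literature.MathematicalPhysics.QuantumFieldTheory
open Summit.CriticalPhenomena.Ising3DConformalLimit.Theses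
open Summit.CriticalPhenomena.Ising3DConformalLimit.MoebiusLimitExistsSketchV13
  (stub_nonCoincident_pathConnected stub_ward_of_pointwise stub_pointwise_of_ward)
open Summit.CriticalPhenomena.Ising3DConformalLimit.MoebiusLimitExistsK1Door
  (inversionUpgradeNormalised_iff_k1WardUpgrade MoebiusLimitExists_iff_existence_and_k1WardStrict)

/-! ## `SCTWardPointwise ⟺ SCTWardWeak` for Ising₃ limits -/

/-- **Pointwise ⟺ weak special-conformal Ward identities for Ising₃ scaling limits** (every level `n`, every weight `Δ'`): the limit is
real-analytic on `NonCoincident 3 n`, so integration by parts goes both ways. [cite: FrancescoMathieuSenechal1997, §4.3.1 (4.51)–(4.54)] -/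
theorem sctWardPointwise_iff_sctWardWeak_of_limit {ρ : ℝ → ℝ} {Δ : ℝ} {S : CorrFamily 3}
    (hρ : ∀ δ ∈ Set.Ioc (0:ℝ) 1, 0 < ρ δ) (hlim : HasPointwiseScalingLimit (criticalCorr 3) ρ S)
    (hnorm : ∀ n z, z ∉ NonCoincident 3 n → S n z = 0) (hnd : IsNondegenerateTwoPoint S)
    (heuc : IsEuclideanInvariant S) (hsc : IsScaleCovariant Δ S) (n : ℕ) (Δ' : ℝ) :
    SCTWardPointwise S Δ' n ↔ SCTWardWeak S Δ' n := by
  have han := analyticOnNhd_limit hρ hlim hnorm hnd heuc hsc n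
  rw [sctWardWeak_iff_coeff S Δ' n (κ := 2 * Δ' - 6) (by push_cast; ring)]
  constructor
  · intro hpt b φ hφ hφc hφU
    exact stub_ward_of_pointwise n (S n) Δ' b (NonCoincident 3 n) (isOpen_nonCoincident 3 n) han
      (fun x hx => hpt b x hx) φ hφ hφc hφU
  · intro hW b x hx
    exact stub_pointwise_of_ward n (S n) Δ' b (NonCoincident 3 n) (isOpen_nonCoincident 3 n) han
      (fun φ hφ hφc hφU => hW b φ hφ hφc hφU) x hx

/-! ## The local pointwise `K_{e₀}` identity at even levels `≥ 4` ⟺ Möbius covariance -/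

/-- **Local pointwise ⟺ local weak** for the single generator `K_{e₀}` on an open `V ⊆ NonCoincident 3 n` (analyticity on `V`).
[cite: FrancescoMathieuSenechal1997, §4.3.1 (4.51)–(4.54)] -/
theorem localPointwise_iff_localWard_of_limit {ρ : ℝ → ℝ} {Δ : ℝ} {S : CorrFamily 3}
    (hρ : ∀ δ ∈ Set.Ioc (0:ℝ) 1, 0 < ρ δ) (hlim : HasPointwiseScalingLimit (criticalCorr 3) ρ S)
    (hnorm : ∀ n z, z ∉ NonCoincident 3 n → S n z = 0) (hnd : IsNondegenerateTwoPoint S)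
    (heuc : IsEuclideanInvariant S) (hsc : IsScaleCovariant Δ S) {n : ℕ} (Δ' : ℝ) (b : EuclideanSpace ℝ (Fin 3))
    {V : Set (Fin n → EuclideanSpace ℝ (Fin 3))} (hV : IsOpen V) (hVsub : V ⊆ NonCoincident 3 n) :
    (∀ x ∈ V, fderiv ℝ (S n) x (fun i => ‖x i‖ ^ 2 • b - (2 * inner ℝ b (x i)) • x i) =
        2 * Δ' * (∑ i, inner ℝ b (x i)) * S n x) ↔
    (∀ (φ : (Fin n → EuclideanSpace ℝ (Fin 3)) → ℝ),
        ContDiff ℝ ((⊤ : ℕ∞) : WithTop ℕ∞) φ → HasCompactSupport φ → tsupport φ ⊆ V →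
        ∫ x, S n x * ((2 * Δ' - 6) * (∑ i, inner ℝ b (x i)) * φ x +
          fderiv ℝ φ x (fun i => ‖x i‖ ^ 2 • b - (2 * inner ℝ b (x i)) • x i)) = 0) := by
  have han := (analyticOnNhd_limit hρ hlim hnorm hnd heuc hsc n).mono hVsub
  exact ⟨stub_ward_of_pointwise n (S n) Δ' b V hV han, stub_pointwise_of_ward n (S n) Δ' b V hV han⟩

/-- **For normalised non-degenerate Euclidean scale-covariant limits of `criticalCorr 3`: the pointwise `K_{e₀}` identity near one
configuration per even level `≥ 4` IS Möbius covariance.** [cite: FrancescoMathieuSenechal1997, §4.3.1 (4.51)–(4.56)] -/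
theorem localPointwiseK1_iff_isMoebiusCovariant_of_limit {ρ : ℝ → ℝ} {Δ : ℝ} {S : CorrFamily 3}
    (hρ : ∀ δ ∈ Set.Ioc (0:ℝ) 1, 0 < ρ δ) (hlim : HasPointwiseScalingLimit (criticalCorr 3) ρ S)
    (hnorm : ∀ n z, z ∉ NonCoincident 3 n → S n z = 0) (hnd : IsNondegenerateTwoPoint S)
    (heuc : IsEuclideanInvariant S) (hsc : IsScaleCovariant Δ S) :
    (∀ n, 4 ≤ n → Even n → ∃ V : Set (Fin n → EuclideanSpace ℝ (Fin 3)),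
        IsOpen V ∧ V.Nonempty ∧ V ⊆ NonCoincident 3 n ∧
        ∀ x ∈ V, fderiv ℝ (S n) x (fun i => ‖x i‖ ^ 2 • (EuclideanSpace.single 0 1 : EuclideanSpace ℝ (Fin 3)) -
            (2 * inner ℝ (EuclideanSpace.single 0 1 : EuclideanSpace ℝ (Fin 3)) (x i)) • x i) =
          2 * Δ * (∑ i, inner ℝ (EuclideanSpace.single 0 1 : EuclideanSpace ℝ (Fin 3)) (x i)) * S n x) ↔
      IsMoebiusCovariant Δ S := by
  rw [← localK1EvenGeFour_iff_isMoebiusCovariant_of_limit hρ hlim hnorm hnd heuc hsc]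
  refine forall_congr' fun n => forall_congr' fun _ => forall_congr' fun _ => exists_congr fun V => ?_
  refine and_congr_right fun hV => and_congr_right fun _ => and_congr_right fun hVsub => ?_
  exact localPointwise_iff_localWard_of_limit hρ hlim hnorm hnd heuc hsc Δ (EuclideanSpace.single 0 1) hV hVsub

/-! ## Item 1982 ⟺ the bare local POINTWISE `K_{e₀}` upgrade (registered anchor) -/

/-- **Item 1982 ⟺ the bare local pointwise single-generator even-level upgrade**: every normalised non-degenerate Euclidean scale-covariant
pointwise limit of the critical `ℤ³` correlators is inversion covariant iff for every such limit and every even `n ≥ 4` the pointwise identity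
`DS_n(x)·K_{e₀}(x) = 2Δ (Σᵢ ⟪e₀, xᵢ⟫) S_n(x)` holds on SOME non-empty open set of non-coincident configurations.
[cite: FrancescoMathieuSenechal1997, §4.3.1 eq. (4.62)] -/
theorem inversionUpgradeNormalised_iff_localPointwiseK1Upgrade : Summit.CriticalPhenomena.Ising3DConformalLimit.Theses.HyperoctahedralRP.InversionUpgradeNormalised ↔ (∀ (ρ : ℝ → ℝ) (Δ : ℝ) (S : Literature.Probability.LatticeModels.CorrFamily 3), (∀ δ ∈ Set.Ioc (0:ℝ) 1, 0 < ρ δ) → Literature.Probability.LatticeModels.HasPointwiseScalingLimit (Literature.Probability.LatticeModels.criticalCorr 3) ρ S → (∀ n z, z ∉ Literature.Probability.LatticeModels.NonCoincident 3 n → S n z = 0) → Literature.Probability.LatticeModels.IsNondegenerateTwoPoint S → Literature.Probability.LatticeModels.IsEuclideanInvariant S → Literature.Probability.LatticeModels.IsScaleCovariant Δ S → ∀ n, 4 ≤ n → Even n → ∃ V : Set (Fin n → EuclideanSpace ℝ (Fin 3)), IsOpen V ∧ V.Nonempty ∧ V ⊆ Literature.Probability.LatticeModels.NonCoincident 3 n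 ∧ ∀ x ∈ V, fderiv ℝ (S n) x (fun i => ‖x i‖ ^ 2 • (EuclideanSpace.single 0 1 : EuclideanSpace ℝ (Fin 3)) - (2 * inner ℝ (EuclideanSpace.single 0 1 : EuclideanSpace ℝ (Fin 3)) (x i)) • x i) = 2 * Δ * (∑ i, inner ℝ (EuclideanSpace.single 0 1 : EuclideanSpace ℝ (Fin 3)) (x i)) * S n x) := by
  rw [inversionUpgradeNormalised_iff_localK1WardUpgrade]
  refine forall_congr' fun ρ => forall_congr' fun Δ => forall_congr' fun S => forall_congr' fun hρ =>
    forall_congr' fun hlim => forall_congr' fun hnorm => forall_congr' fun hnd => forall_congr' fun heuc =>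
    forall_congr' fun hsc => ?_
  refine forall_congr' fun n => forall_congr' fun _ => forall_congr' fun _ => exists_congr fun V => ?_
  refine and_congr_right fun hV => and_congr_right fun _ => and_congr_right fun hVsub => ?_
  exact (localPointwise_iff_localWard_of_limit hρ hlim hnorm hnd heuc hsc Δ (EuclideanSpace.single 0 1) hV hVsub).symm

/-! ## The crux ⟺ item 1981 ∧ 7⁗_loc,pt -/

/-- **`MoebiusLimitExists ⟺ ExistsScaleCovariantLimit (1981) ∧ 7⁗_loc,pt`** — the residual of crux 1344 as a first-order linear PDE on an
arbitrarily small open set of configurations, at the even levels `n ≥ 4` (idle window / `U₄` / OS / clustering premises kept from the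
registered stub). [cite: DuminilCopinICM2022, §8.4] -/
theorem MoebiusLimitExists_iff_existence_and_localPointwiseK1Strict :
    PerfectScreening.MoebiusLimitExists ↔
      HyperoctahedralRP.ExistsScaleCovariantLimit ∧
      (∀ (ρ : ℝ → ℝ) (Δ : ℝ) (S : CorrFamily 3), (∀ δ ∈ Set.Ioc (0:ℝ) 1, 0 < ρ δ) →
        HasPointwiseScalingLimit (criticalCorr 3) ρ S → (∀ n z, z ∉ NonCoincident 3 n → S n z = 0) →
        IsNondegenerateTwoPoint S → IsEuclideanInvariant S → IsScaleCovariant Δ S →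
        1 / 2 < Δ → Δ ≤ 3 / 4 → HasNontrivialU4 S →
        (∀ τ : Fin 3, PointwiseOSReconstruction τ S) →
        (∀ (n m : ℕ) (x : Fin n → EuclideanSpace ℝ (Fin 3)) (y : Fin m → EuclideanSpace ℝ (Fin 3))
          (v : EuclideanSpace ℝ (Fin 3)), v ≠ 0 →
          Tendsto (fun t : ℝ => S (n + m) (Fin.append x (fun j => y j + t • v)) - S n x * S m y)
            atTop (𝓝 0)) →
        ∀ n, 4 ≤ n → Even n → ∃ V : Set (Fin n → EuclideanSpace ℝ (Fin 3)),
          IsOpen V ∧ V.Nonempty ∧ V ⊆ NonCoincident 3 n ∧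
          ∀ x ∈ V, fderiv ℝ (S n) x (fun i => ‖x i‖ ^ 2 • (EuclideanSpace.single 0 1 : EuclideanSpace ℝ (Fin 3)) -
              (2 * inner ℝ (EuclideanSpace.single 0 1 : EuclideanSpace ℝ (Fin 3)) (x i)) • x i) =
            2 * Δ * (∑ i, inner ℝ (EuclideanSpace.single 0 1 : EuclideanSpace ℝ (Fin 3)) (x i)) * S n x) := by
  rw [MoebiusLimitExists_iff_existence_and_localK1WardStrict]
  refine and_congr_right fun _ => ?_
  refine forall_congr' fun ρ => forall_congr' fun Δ => forall_congr' fun S => forall_congr' fun hρ =>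
    forall_congr' fun hlim => forall_congr' fun hnorm => forall_congr' fun hnd => forall_congr' fun heuc =>
    forall_congr' fun hsc => ?_
  refine forall_congr' fun _ => forall_congr' fun _ => forall_congr' fun _ => forall_congr' fun _ =>
    forall_congr' fun _ => forall_congr' fun n => forall_congr' fun _ => forall_congr' fun _ => exists_congr fun V => ?_
  refine and_congr_right fun hV => and_congr_right fun _ => and_congr_right fun hVsub => ?_
  exact (localPointwise_iff_localWard_of_limit hρ hlim hnorm hnd heuc hsc Δ (EuclideanSpace.single 0 1) hV hVsub).symm

end Summit.CriticalPhenomena.Ising3DConformalLimit.MoebiusLimitExistsLocalWard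

end
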